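import Literature.NumberTheory.EllipticCurves.CongruentNumberCurveLValueTwo
import Literature.NumberTheory.EllipticCurves.GaussianLatticeFifthDiagonal
import Literature.NumberTheory.EllipticCurves.GaussianLatticeThirdValues
import HarnessLib

/-!
# `L(E₁₀, 1) = 2β/√10` for `y² = x³ − 100x`, and the discharge of
# `BirchSwinnertonDyer1965_L_one_two_ten`

Topic `Literature/NumberTheory/EllipticCurves` (Tunnell cluster). Proof file for the named fact
`Literature.NumberTheory.EllipticCurves.BirchSwinnertonDyer1965_L_one_two_ten` of
`BSDAnalyticRankTunnellWaldspurgerProofs` — the two CM `L`-values `L(E₂, 1) = β/(2√2)`,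
`L(E₁₀, 1) = 2β/√10` fixing the constants in the even case of Tunnell's Theorem 3 (Invent. Math.
72 (1983), p. 329: "comparing with the tables of [3] to find `L(E², 1)` and `L(E¹⁰, 1)`";
Birch–Swinnerton-Dyer, Crelle 218 (1965), Table 1). The first value is
`CongruentNumberCurveLValueTwo`; here the second is **proved**
(`entireLFunction_congruentNumberCurve_ten_one`), the fact is discharged
(`BirchSwinnertonDyer1965_L_one_two_ten_holds`), and Tunnell's even case is reduced to
Waldspurger's proportionality alone (`Tunnell1983_L_one_even_of_b_sq`). Everything is proved;
there are no definitions and no named facts.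

## Proof of `L(E₁₀, 1) = 2β/√10`

By `CongruentNumberCurveLValueKronecker`, `L(E_n, 1) = (4M)⁻¹ Σ_{c ∈ ℤ[i]/M} ψ_n(c) conj E₁*(c/M)`
for any period `M` of `ψ_n = heckePsi n = (n/N(·)) u(·)` (`E₁* = ζ_Λ − π conj`, the
Eisenstein–Kronecker function of `Λ = ℤi + ℤ`, `GaussianLatticeQuarterValues`).

1. `ψ₁₀` has period `20` (`heckePsi_ten_add_twenty_mul`: the unit part sees `x mod 4`,
   `(10/N x)` sees `N x mod 40`), and along the CRT bijection `(a, b) ↦ 5a + 4b`,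
   `ℤ[i]/4 × ℤ[i]/5 → ℤ[i]/20` (`cls_five_mul_add_four_mul_bijective`), it factors as
   `ψ₁₀(5a + 4b) = ψ₂(a) χ₅(b)`, `χ₅(b) = (N b/5)` (`heckePsi_ten_five_mul_add_four_mul`:
   `(5/N) = (N/5)` by reciprocity, `N(5a+4b) ≡ N(b) (mod 5)`), while `(5a+4b)/20 = a/4 + b/5`.
   Hence `L(E₁₀, 1) = (1/80) Σ_{a mod 4} ψ₂(a) conj FS(a/4)` with the **twisted fifth-division
   sum** `FS(u) = Σ_{b mod 5} χ₅(b) E₁*(u + b/5)` (`entireLFunction_congruentNumberCurve_ten_one_eq_sum`,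
   through the general change of representatives `sum_classes_eq_sum_of_bijective`).
2. `χ₅ = +1` on the unit orbits of `1, 2`, `−1` on those of `1+i, 2+2i`, `0` elsewhere, so
   `FS(u)` is a signed sum of `E₁*` over four unit orbits `u ± v, u ± iv` (`fifth_twisted_sum_expand`);
   it inherits `FS(−u) = −FS(u)`, `FS(iu) = −iFS(u)`, `FS(u + l) = FS(u)` from `E₁*`, so the
   `ψ₂`-weighted sum over `ℤ[i]/4` collapses exactly as for `L(E₂, 1)`:
   `Σ_a ψ₂(a) conj FS(a/4) = 4(conj FS(1/4) − conj FS((3+2i)/4))`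
   (`sum_heckePsi_two_mul_conj_eq`, for any unit-equivariant periodic `F`).
3. Over one unit orbit, `E₁*(u+v) + E₁*(u−v) + E₁*(u+iv) + E₁*(u−iv) = 4E₁*(u) + 2℘'(u)℘(u)/(℘(u)² − ℘(v)²)`
   (`kroneckerE₁_unit_orbit_sum`, from `E₁*(u+v) + E₁*(u−v) − 2E₁*(u) = ℘'(u)/(℘(u) − ℘(v))`,
   `GaussianLatticeThirdValues`), the `4E₁*(u)` cancel in the signed sum, and only the squares
   `℘(v)²` of the fifth-division values enter, pairwise through their symmetric functions
   `℘(1/5)² + ℘(2/5)² = (6 + 4√5)ϖ₀⁴`, `℘(1/5)²℘(2/5)² = (9 + 4√5)ϖ₀⁸` (`GaussianLatticeFifthDivision`)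
   and `℘((1+i)/5)² + ℘((2+2i)/5)² = (6 − 4√5)ϖ₀⁴`, `℘((1+i)/5)²℘((2+2i)/5)² = (9 − 4√5)ϖ₀⁸`
   (`GaussianLatticeFifthDiagonal`); with `℘, ℘'` at `1/4` and `(3+2i)/4`
   (`(1 ± √2)ϖ₀²`, `−2√2(1+√2)ϖ₀³`, `−2(2−√2)ϖ₀³`) this gives `FS(1/4) = 2√10 ϖ₀`,
   `FS((3+2i)/4) = −2√10 ϖ₀` (identities in `ℚ(√2, √5)`; no division value is located
   individually, and all denominators are `Π(℘(u)² − ℘(v)²) ≠ 0` because `℘(u) = ±℘(v)` with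
   `4u, 5v ∈ Λ` would force `u ∈ Λ`, `weierstrassP_quarter_ne_fifth`).
4. `L(E₁₀, 1) = (4/80) · 4√10 ϖ₀ = 2ϖ₀/√10`, and `ϖ₀ = Γ(1/4)²/(2√(2π)) = β` (`tunnellPeriod_eq_varpi`).

Numerically `L(E₁₀, 1) = 1.658357…`, matching `2β/√10` with `β = 2.622057…`.

## References

* J. B. Tunnell, *A classical Diophantine problem and modular forms of weight 3/2*, Invent. Math.
  72 (1983) 323–334, proof of Thm 3, p. 329.
* B. J. Birch, H. P. F. Swinnerton-Dyer, *Notes on elliptic curves. II*, J. reine angew. Math. 218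
  (1965) 79–108, §3 (3.5)–(3.15) and Table 1 (row 25, column `−D`: `σ = 2`).
-/

noncomputable section

open Complex Real Set Filter Topology PeriodPair
open scoped Real Topology PeriodPair ComplexConjugate

namespace Literature.NumberTheory.EllipticCurves

open Literature.NumberTheory.LFunctions Literature.NumberTheory.LFunctions.GaussianTheta
  GaussianLattice GaussianPrimary Literature.NumberTheory.QuadraticFields.GaussianPrimary

/-! ### `ψ₁₀` is periodic modulo `20` -/

/-- `N(x + 20y) ≡ N(x) (mod 40)`. [folklore] -/
theorem norm_add_twenty_mul_emod_forty (x y : GaussianInt) :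
    (x + 20 * y).norm % 40 = x.norm % 40 := by
  have : (x + 20 * y).norm =
      x.norm + 40 * (x.re * y.re + x.im * y.im + 10 * (y.re * y.re + y.im * y.im)) := by
    simp only [Zsqrtd.norm_def, Zsqrtd.re_add, Zsqrtd.im_add, Zsqrtd.re_mul, Zsqrtd.im_mul]
    have h1 : (20 : GaussianInt).re = 20 := rfl
    have h2 : (20 : GaussianInt).im = 0 := rfl
    rw [h1, h2]
    ring
  rw [this, Int.add_mul_emod_self_left]

/-- **`ψ₁₀ = heckePsi 10` is periodic modulo `20`** (not only modulo `40`): the unit part depends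
on `x mod 4`, and `(10/N(x))` on `N(x) mod 40`, which depends on `x mod 20`. [folklore] -/
theorem heckePsi_ten_add_twenty_mul (x y : GaussianInt) :
    heckePsi 10 (x + ((20 : ℕ) : GaussianInt) * y) = heckePsi 10 x := by
  have h20 : ((20 : ℕ) : GaussianInt) = 20 := by norm_num
  have hu : primaryUnit (x + 20 * y) = primaryUnit x := by
    have := primaryUnit_add_natCast_mul (M := 20) (by norm_num) x y
    rwa [h20] at this
  rw [h20]
  unfold heckePsi
  rw [hu]
  by_cases hodd : (x.re + x.im) % 2 = 1
  · congr 2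
    have hx2 : x.norm % 2 = 1 := by rw [norm_emod_two]; exact hodd
    have hmod := norm_add_twenty_mul_emod_forty x y
    have hx2' : (x + 20 * y).norm % 2 = 1 := by omega
    have hodd1 : Odd (x + 20 * y).norm.natAbs := Int.natAbs_odd.mpr (Int.odd_iff.mpr hx2')
    have hodd2 : Odd x.norm.natAbs := Int.natAbs_odd.mpr (Int.odd_iff.mpr hx2)
    rw [jacobiSym.mod_right _ hodd1, jacobiSym.mod_right _ hodd2]
    congr 1
    have h0 : 0 ≤ (x + 20 * y).norm := GaussianInt.norm_nonneg _
    have h0' : 0 ≤ x.norm := GaussianInt.norm_nonneg _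
    show (x + 20 * y).norm.natAbs % 40 = x.norm.natAbs % 40
    omega
  · have heven : (x.re + x.im) % 2 = 0 := by omega
    rw [primaryUnit_eq_zero_of_even heven]
    simp

/-! ### `ψ₁₀(5a + 4b) = ψ₂(a) χ₅(b)` -/

/-- `N(5a + 4b) = 25 N(a) + 40(…) + 16 N(b)`. [folklore] -/
theorem norm_five_mul_add_four_mul (a b : GaussianInt) :
    (5 * a + 4 * b).norm = 25 * a.norm + 40 * (a.re * b.re + a.im * b.im) + 16 * b.norm := by
  simp only [Zsqrtd.norm_def, Zsqrtd.re_add, Zsqrtd.im_add, Zsqrtd.re_mul, Zsqrtd.im_mul]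
  have h1 : (5 : GaussianInt).re = 5 := rfl
  have h2 : (5 : GaussianInt).im = 0 := rfl
  have h3 : (4 : GaussianInt).re = 4 := rfl
  have h4 : (4 : GaussianInt).im = 0 := rfl
  rw [h1, h2, h3, h4]
  ring

/-- **The CRT factorisation of `ψ₁₀`**: `ψ₁₀(5a + 4b) = ψ₂(a) · (N(b)/5)` for all
`a, b ∈ ℤ[i]` (`5a + 4b ≡ a (mod 4)` fixes the unit part and `(2/N)`; `(5/N) = (N/5)` by
reciprocity, and `N(5a + 4b) ≡ 16 N(b) ≡ N(b) (mod 5)`). [folklore] -/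
theorem heckePsi_ten_five_mul_add_four_mul (a b : GaussianInt) :
    heckePsi 10 (5 * a + 4 * b) = heckePsi 2 a * ((jacobiSym b.norm 5 : ℤ) : ℂ) := by
  have hx : 5 * a + 4 * b = a + 4 * (a + b) := by ring
  have hu : primaryUnit (5 * a + 4 * b) = primaryUnit a := by
    rw [hx]
    have := primaryUnit_add_natCast_mul (M := 4) dvd_rfl a (a + b)
    rwa [show ((4 : ℕ) : GaussianInt) = 4 by norm_num] at this
  unfold heckePsi
  rw [hu]
  simp only [Nat.cast_ofNat]
  by_cases hodd : (a.re + a.im) % 2 = 1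
  · have hNa : a.norm % 2 = 1 := by rw [norm_emod_two]; exact hodd
    have h8 : (5 * a + 4 * b).norm % 8 = a.norm % 8 := by
      rw [hx]; exact norm_add_four_mul_emod_eight a (a + b)
    have hNx : (5 * a + 4 * b).norm % 2 = 1 := by omega
    have hodd1 : Odd (5 * a + 4 * b).norm.natAbs := Int.natAbs_odd.mpr (Int.odd_iff.mpr hNx)
    have hodd2 : Odd a.norm.natAbs := Int.natAbs_odd.mpr (Int.odd_iff.mpr hNa)
    have h0 : 0 ≤ (5 * a + 4 * b).norm := GaussianInt.norm_nonneg _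
    have h0' : 0 ≤ a.norm := GaussianInt.norm_nonneg _
    have hsplit : jacobiSym 10 (5 * a + 4 * b).norm.natAbs =
        jacobiSym 2 (5 * a + 4 * b).norm.natAbs * jacobiSym 5 (5 * a + 4 * b).norm.natAbs := by
      rw [show (10 : ℤ) = 2 * 5 by norm_num]
      exact jacobiSym.mul_left 2 5 _
    have h2 : jacobiSym 2 (5 * a + 4 * b).norm.natAbs = jacobiSym 2 a.norm.natAbs := by
      rw [jacobiSym.mod_right _ hodd1, jacobiSym.mod_right _ hodd2]
      congr 1
      show (5 * a + 4 * b).norm.natAbs % 8 = a.norm.natAbs % 8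
      omega
    have h5 : jacobiSym 5 (5 * a + 4 * b).norm.natAbs = jacobiSym b.norm 5 := by
      have hrec : jacobiSym 5 (5 * a + 4 * b).norm.natAbs =
          jacobiSym ((5 * a + 4 * b).norm.natAbs : ℤ) 5 :=
        jacobiSym.quadratic_reciprocity_one_mod_four (by norm_num) hodd1
      rw [hrec, jacobiSym.mod_left _ 5, jacobiSym.mod_left b.norm 5]
      congr 1
      rw [Int.natCast_natAbs, abs_of_nonneg h0, norm_five_mul_add_four_mul]
      omega
    rw [hsplit, h2, h5]
    push_cast
    ring
  · have heven : (a.re + a.im) % 2 = 0 := by omega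
    rw [primaryUnit_eq_zero_of_even heven]
    simp

/-! ### `E₁*` is periodic under `ℤ[i]` -/

/-- `ℤ[i] ⊆ Λ = ℤi + ℤ` (as complex numbers; a local copy of the two-line helper of
`BSDAnalyticRankTunnellWaldspurgerLValuesProofs`, not imported here). [folklore] -/
private theorem toComplex_mem_lattice' (y : GaussianInt) :
    ((y : ℂ)) ∈ (ofUpperHalfPlane UpperHalfPlane.I).lattice := by
  rw [← coe_gaussianIntEquivLattice]; exact (gaussianIntEquivLattice y).2

/-- The summand `ψ₁₀(x) conj E₁*(x/20)` is `20`-periodic. [folklore] -/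
theorem heckePsi_ten_mul_conj_kroneckerE₁_periodic (x y : GaussianInt) :
    heckePsi 10 (x + ((20 : ℕ) : GaussianInt) * y) *
        conj (kroneckerE₁ (((x + ((20 : ℕ) : GaussianInt) * y : GaussianInt) : ℂ) / ((20 : ℕ) : ℂ))) =
      heckePsi 10 x * conj (kroneckerE₁ ((x : ℂ) / ((20 : ℕ) : ℂ))) := by
  rw [heckePsi_ten_add_twenty_mul]
  congr 2
  have : (((x + ((20 : ℕ) : GaussianInt) * y : GaussianInt) : ℂ) / ((20 : ℕ) : ℂ)) =
      (x : ℂ) / ((20 : ℕ) : ℂ) + (y : ℂ) := by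
    simp only [map_add, map_mul, map_natCast]
    push_cast
    ring
  rw [this, kroneckerE₁_add_of_mem _ (toComplex_mem_lattice' y)]

/-! ### Summing a periodic function over `ℤ[i]/M` through any system of representatives -/

/-- **Change of representatives.** If `g` is `M`-periodic on `ℤ[i]` and `r : ι → ℤ[i]` hits every
class modulo `M` exactly once, then `Σ_{c mod M} g(rep c) = Σ_i g(r i)`. [folklore] -/
theorem sum_classes_eq_sum_of_bijective {ι : Type*} [Fintype ι] (M : ℕ) [NeZero M]
    (r : ι → GaussianInt) (hr : Function.Bijective fun i ↦ cls M (r i)) (g : GaussianInt → ℂ)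
    (hg : ∀ x y : GaussianInt, g (x + M * y) = g x) :
    ∑ c : ZMod M × ZMod M, g (rep M c 0) = ∑ i, g (r i) := by
  rw [← hr.sum_comp fun c ↦ g (rep M c 0)]
  refine Finset.sum_congr rfl fun i _ ↦ ?_
  obtain ⟨y, hy⟩ := exists_rep_eq M (rfl : cls M (r i) = cls M (r i))
  calc g (rep M (cls M (r i)) 0) = g (rep M (cls M (r i)) y) := by
        rw [rep_eq_rep_zero_add M (cls M (r i)) y, hg]
    _ = g (r i) := by rw [hy]

/-! ### The CRT system of representatives `5a + 4b`, `a mod 4`, `b mod 5` -/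

/-- Real part of `5a + 4b` on representatives. [folklore] -/
theorem re_five_mul_rep_add_four_mul_rep (a : ZMod 4 × ZMod 4) (b : ZMod 5 × ZMod 5) :
    (5 * rep 4 a 0 + 4 * rep 5 b 0).re = 5 * (a.1.val : ℤ) + 4 * (b.1.val : ℤ) := by
  simp only [Zsqrtd.re_add, Zsqrtd.re_mul, rep_re, rep_im, Prod.fst_zero, Prod.snd_zero,
    mul_zero, add_zero]
  have h1 : (5 : GaussianInt).re = 5 := rfl
  have h2 : (5 : GaussianInt).im = 0 := rfl
  have h3 : (4 : GaussianInt).re = 4 := rfl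
  have h4 : (4 : GaussianInt).im = 0 := rfl
  rw [h1, h2, h3, h4]
  ring

/-- Imaginary part of `5a + 4b` on representatives. [folklore] -/
theorem im_five_mul_rep_add_four_mul_rep (a : ZMod 4 × ZMod 4) (b : ZMod 5 × ZMod 5) :
    (5 * rep 4 a 0 + 4 * rep 5 b 0).im = 5 * (a.2.val : ℤ) + 4 * (b.2.val : ℤ) := by
  simp only [Zsqrtd.im_add, Zsqrtd.im_mul, rep_re, rep_im, Prod.fst_zero, Prod.snd_zero,
    mul_zero, add_zero]
  have h1 : (5 : GaussianInt).re = 5 := rfl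
  have h2 : (5 : GaussianInt).im = 0 := rfl
  have h3 : (4 : GaussianInt).re = 4 := rfl
  have h4 : (4 : GaussianInt).im = 0 := rfl
  rw [h1, h2, h3, h4]
  ring

/-- The one-dimensional CRT: `(α, β) ↦ 5α + 4β mod 20` is injective on `ℤ/4 × ℤ/5`. [folklore] -/
theorem crt_four_five_injective {α α' : ZMod 4} {β β' : ZMod 5}
    (h : ((5 * (α.val : ℤ) + 4 * (β.val : ℤ) : ℤ) : ZMod 20) =
      ((5 * (α'.val : ℤ) + 4 * (β'.val : ℤ) : ℤ) : ZMod 20)) :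
    α = α' ∧ β = β' := by
  rw [ZMod.intCast_eq_intCast_iff_dvd_sub] at h
  obtain ⟨k, hk⟩ := h
  have hα := ZMod.val_lt α
  have hα' := ZMod.val_lt α'
  have hβ := ZMod.val_lt β
  have hβ' := ZMod.val_lt β'
  have h1 : α.val = α'.val := by omega
  have h2 : β.val = β'.val := by omega
  exact ⟨ZMod.val_injective 4 h1, ZMod.val_injective 5 h2⟩

/-- **`(a, b) ↦ 5a + 4b` is a bijection `ℤ[i]/4 × ℤ[i]/5 → ℤ[i]/20`** (Chinese remainder
theorem). [folklore] -/
theorem cls_five_mul_add_four_mul_bijective :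
    Function.Bijective fun p : (ZMod 4 × ZMod 4) × (ZMod 5 × ZMod 5) ↦
      cls 20 (5 * rep 4 p.1 0 + 4 * rep 5 p.2 0) := by
  rw [Fintype.bijective_iff_injective_and_card]
  refine ⟨?_, by simp [Fintype.card_prod, ZMod.card]⟩
  rintro ⟨a, b⟩ ⟨a', b'⟩ h
  have h1 := congrArg Prod.fst h
  have h2 := congrArg Prod.snd h
  simp only [cls, re_five_mul_rep_add_four_mul_rep, im_five_mul_rep_add_four_mul_rep] at h1 h2
  obtain ⟨ha1, hb1⟩ := crt_four_five_injective h1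
  obtain ⟨ha2, hb2⟩ := crt_four_five_injective h2
  simp only [Prod.mk.injEq]
  exact ⟨Prod.ext ha1 ha2, Prod.ext hb1 hb2⟩

/-! ### `L(E₁₀, 1)` as a double sum -/

/-- `10` is squarefree. [folklore] -/
theorem squarefree_ten : Squarefree 10 := by
  rw [show (10 : ℕ) = 2 * 5 by norm_num, Nat.squarefree_mul (by norm_num)]
  exact ⟨Nat.squarefree_two, (by norm_num : Nat.Prime 5).prime.squarefree⟩

/-- **`L(E₁₀, 1)` through the CRT decomposition**:
`L(E₁₀, 1) = (1/80) Σ_{a mod 4} ψ₂(a) conj( Σ_{b mod 5} (N b/5) E₁*(a/4 + b/5) )`. [folklore] -/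
theorem entireLFunction_congruentNumberCurve_ten_one_eq_sum :
    (congruentNumberCurve 10).entireLFunction 1 =
      (1 / 80 : ℂ) * ∑ a : ZMod 4 × ZMod 4, heckePsi 2 (rep 4 a 0) *
        conj (∑ b : ZMod 5 × ZMod 5, ((jacobiSym (rep 5 b 0).norm 5 : ℤ) : ℂ) *
          kroneckerE₁ ((rep 4 a 0 : ℂ) / 4 + (rep 5 b 0 : ℂ) / 5)) := by
  rw [entireLFunction_congruentNumberCurve_one_eq_sum squarefree_ten 20 heckePsi_ten_add_twenty_mul,
    sum_classes_eq_sum_of_bijective 20 _ cls_five_mul_add_four_mul_bijective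
      (fun x ↦ heckePsi 10 x * conj (kroneckerE₁ ((x : ℂ) / ((20 : ℕ) : ℂ))))
      heckePsi_ten_mul_conj_kroneckerE₁_periodic,
    Fintype.sum_prod_type]
  simp only []
  rw [show (1 / 4 : ℂ) * ((20 : ℕ) : ℂ)⁻¹ = 1 / 80 by norm_num, Finset.mul_sum, Finset.mul_sum]
  refine Finset.sum_congr rfl fun a _ ↦ ?_
  simp only [map_sum, Finset.mul_sum]
  refine Finset.sum_congr rfl fun b _ ↦ ?_
  rw [heckePsi_ten_five_mul_add_four_mul, map_mul, map_intCast]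
  have : (((5 * rep 4 a 0 + 4 * rep 5 b 0 : GaussianInt)) : ℂ) / ((20 : ℕ) : ℂ) =
      (rep 4 a 0 : ℂ) / 4 + (rep 5 b 0 : ℂ) / 5 := by
    simp only [map_add, map_mul, map_ofNat]
    push_cast
    ring
  rw [this]
  ring


/-! ### Sums over `ℤ[i]/5` -/

/-- `Finset.univ` of `ZMod 5`. [folklore] -/
theorem univ_zmod_five : (Finset.univ : Finset (ZMod 5)) = {0, 1, 2, 3, 4} := by decide

/-- Expansion of a sum over `ZMod 5`. [folklore] -/
theorem sum_univ_zmod_five (g : ZMod 5 → ℂ) :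
    ∑ a : ZMod 5, g a = g 0 + g 1 + g 2 + g 3 + g 4 := by
  rw [univ_zmod_five, Finset.sum_insert (by decide), Finset.sum_insert (by decide),
    Finset.sum_insert (by decide), Finset.sum_insert (by decide), Finset.sum_singleton]
  ring

/-- Expansion of a sum over `ℤ[i]/5` into its twenty-five representatives. [folklore] -/
theorem sum_zmod_five_prod (f : ZMod 5 × ZMod 5 → ℂ) :
    ∑ c : ZMod 5 × ZMod 5, f c =
      f (0, 0) + f (0, 1) + f (0, 2) + f (0, 3) + f (0, 4) +
      (f (1, 0) + f (1, 1) + f (1, 2) + f (1, 3) + f (1, 4)) +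
      (f (2, 0) + f (2, 1) + f (2, 2) + f (2, 3) + f (2, 4)) +
      (f (3, 0) + f (3, 1) + f (3, 2) + f (3, 3) + f (3, 4)) +
      (f (4, 0) + f (4, 1) + f (4, 2) + f (4, 3) + f (4, 4)) := by
  rw [Fintype.sum_prod_type, sum_univ_zmod_five]
  simp only [sum_univ_zmod_five]

/-- The representatives `rep 5 (a, b) 0 = ⟨a, b⟩`. [folklore] -/
theorem rep_five_values :
    rep 5 ((0 : ZMod 5), (0 : ZMod 5)) 0 = ⟨0, 0⟩ ∧
    rep 5 ((0 : ZMod 5), (1 : ZMod 5)) 0 = ⟨0, 1⟩ ∧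
    rep 5 ((0 : ZMod 5), (2 : ZMod 5)) 0 = ⟨0, 2⟩ ∧
    rep 5 ((0 : ZMod 5), (3 : ZMod 5)) 0 = ⟨0, 3⟩ ∧
    rep 5 ((0 : ZMod 5), (4 : ZMod 5)) 0 = ⟨0, 4⟩ ∧
    rep 5 ((1 : ZMod 5), (0 : ZMod 5)) 0 = ⟨1, 0⟩ ∧
    rep 5 ((1 : ZMod 5), (1 : ZMod 5)) 0 = ⟨1, 1⟩ ∧
    rep 5 ((1 : ZMod 5), (2 : ZMod 5)) 0 = ⟨1, 2⟩ ∧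
    rep 5 ((1 : ZMod 5), (3 : ZMod 5)) 0 = ⟨1, 3⟩ ∧
    rep 5 ((1 : ZMod 5), (4 : ZMod 5)) 0 = ⟨1, 4⟩ ∧
    rep 5 ((2 : ZMod 5), (0 : ZMod 5)) 0 = ⟨2, 0⟩ ∧
    rep 5 ((2 : ZMod 5), (1 : ZMod 5)) 0 = ⟨2, 1⟩ ∧
    rep 5 ((2 : ZMod 5), (2 : ZMod 5)) 0 = ⟨2, 2⟩ ∧
    rep 5 ((2 : ZMod 5), (3 : ZMod 5)) 0 = ⟨2, 3⟩ ∧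
    rep 5 ((2 : ZMod 5), (4 : ZMod 5)) 0 = ⟨2, 4⟩ ∧
    rep 5 ((3 : ZMod 5), (0 : ZMod 5)) 0 = ⟨3, 0⟩ ∧
    rep 5 ((3 : ZMod 5), (1 : ZMod 5)) 0 = ⟨3, 1⟩ ∧
    rep 5 ((3 : ZMod 5), (2 : ZMod 5)) 0 = ⟨3, 2⟩ ∧
    rep 5 ((3 : ZMod 5), (3 : ZMod 5)) 0 = ⟨3, 3⟩ ∧
    rep 5 ((3 : ZMod 5), (4 : ZMod 5)) 0 = ⟨3, 4⟩ ∧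
    rep 5 ((4 : ZMod 5), (0 : ZMod 5)) 0 = ⟨4, 0⟩ ∧
    rep 5 ((4 : ZMod 5), (1 : ZMod 5)) 0 = ⟨4, 1⟩ ∧
    rep 5 ((4 : ZMod 5), (2 : ZMod 5)) 0 = ⟨4, 2⟩ ∧
    rep 5 ((4 : ZMod 5), (3 : ZMod 5)) 0 = ⟨4, 3⟩ ∧
    rep 5 ((4 : ZMod 5), (4 : ZMod 5)) 0 = ⟨4, 4⟩ := by
  refine ⟨?_, ?_, ?_, ?_, ?_, ?_, ?_, ?_, ?_, ?_, ?_, ?_, ?_, ?_, ?_, ?_, ?_, ?_, ?_, ?_, ?_, ?_, ?_, ?_, ?_⟩ <;> decide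

/-- **The twisted fifth-division sum of `E₁*`, expanded**: with `χ₅(b) = (N b/5)` (`= +1` on the
unit orbits of `1, 2`, `= −1` on those of `1 + i, 2 + 2i`, `= 0` on `0` and on the multiples of
`2 ± i`), `Σ_{b mod 5} χ₅(b) E₁*(u + b/5)` is the signed sum of `E₁*` over the four unit orbits
`u ± v, u ± iv`, `v = 1/5, 2/5, (1+i)/5, (2+2i)/5` (`Λ`-periodicity of `E₁*`). [folklore] -/
theorem fifth_twisted_sum_expand (u : ℂ) :
    ∑ b : ZMod 5 × ZMod 5, ((jacobiSym (rep 5 b 0).norm 5 : ℤ) : ℂ) *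
        kroneckerE₁ (u + (rep 5 b 0 : ℂ) / 5) =
      (kroneckerE₁ (u + 1 / 5) + kroneckerE₁ (u - 1 / 5) +
          kroneckerE₁ (u + I * (1 / 5)) + kroneckerE₁ (u - I * (1 / 5))) +
        (kroneckerE₁ (u + 2 / 5) + kroneckerE₁ (u - 2 / 5) +
          kroneckerE₁ (u + I * (2 / 5)) + kroneckerE₁ (u - I * (2 / 5))) -
        (kroneckerE₁ (u + (1 + I) / 5) + kroneckerE₁ (u - (1 + I) / 5) +
          kroneckerE₁ (u + I * ((1 + I) / 5)) + kroneckerE₁ (u - I * ((1 + I) / 5))) -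
        (kroneckerE₁ (u + (2 + 2 * I) / 5) + kroneckerE₁ (u - (2 + 2 * I) / 5) +
          kroneckerE₁ (u + I * ((2 + 2 * I) / 5)) + kroneckerE₁ (u - I * ((2 + 2 * I) / 5))) := by
  obtain ⟨r00, r01, r02, r03, r04, r10, r11, r12, r13, r14, r20, r21, r22, r23, r24, r30, r31, r32, r33, r34, r40, r41, r42, r43, r44⟩ := rep_five_values
  rw [sum_zmod_five_prod]
  simp only [r00, r01, r02, r03, r04, r10, r11, r12, r13, r14, r20, r21, r22, r23, r24, r30, r31, r32, r33, r34, r40, r41, r42, r43, r44]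
  norm_num [Zsqrtd.norm_def, GaussianInt.toComplex_def']
  have h01 : kroneckerE₁ (u + I / 5) = kroneckerE₁ (u + I * (1 / 5)) := by ring_nf
  have h02 : kroneckerE₁ (u + 2 * I / 5) = kroneckerE₁ (u + I * (2 / 5)) := by ring_nf
  have h03 : kroneckerE₁ (u + 3 * I / 5) = kroneckerE₁ (u - I * (2 / 5)) := by
    rw [show u + 3 * I / 5 = (u - I * (2 / 5)) + I by ring, kroneckerE₁_add_I]
  have h04 : kroneckerE₁ (u + 4 * I / 5) = kroneckerE₁ (u - I * (1 / 5)) := by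
    rw [show u + 4 * I / 5 = (u - I * (1 / 5)) + I by ring, kroneckerE₁_add_I]
  have h30 : kroneckerE₁ (u + 3 / 5) = kroneckerE₁ (u - 2 / 5) := by
    rw [show u + 3 / 5 = (u - 2 / 5) + 1 by ring, kroneckerE₁_add_one]
  have h40 : kroneckerE₁ (u + 4 / 5) = kroneckerE₁ (u - 1 / 5) := by
    rw [show u + 4 / 5 = (u - 1 / 5) + 1 by ring, kroneckerE₁_add_one]
  have h33 : kroneckerE₁ (u + (3 + 3 * I) / 5) = kroneckerE₁ (u - (2 + 2 * I) / 5) := by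
    rw [show u + (3 + 3 * I) / 5 = (u - (2 + 2 * I) / 5) + (1 + I) by ring,
      kroneckerE₁_add_of_mem _ one_add_I_mem]
  have h44 : kroneckerE₁ (u + (4 + 4 * I) / 5) = kroneckerE₁ (u - (1 + I) / 5) := by
    rw [show u + (4 + 4 * I) / 5 = (u - (1 + I) / 5) + (1 + I) by ring,
      kroneckerE₁_add_of_mem _ one_add_I_mem]
  have h14 : kroneckerE₁ (u + (1 + 4 * I) / 5) = kroneckerE₁ (u - I * ((1 + I) / 5)) := by
    rw [show u + (1 + 4 * I) / 5 = (u - I * ((1 + I) / 5)) + I by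
      linear_combination (1 / 5 : ℂ) * I_sq, kroneckerE₁_add_I]
  have h41 : kroneckerE₁ (u + (4 + I) / 5) = kroneckerE₁ (u + I * ((1 + I) / 5)) := by
    rw [show u + (4 + I) / 5 = (u + I * ((1 + I) / 5)) + 1 by
      linear_combination (-1 / 5 : ℂ) * I_sq, kroneckerE₁_add_one]
  have h23 : kroneckerE₁ (u + (2 + 3 * I) / 5) = kroneckerE₁ (u - I * ((2 + 2 * I) / 5)) := by
    rw [show u + (2 + 3 * I) / 5 = (u - I * ((2 + 2 * I) / 5)) + I by
      linear_combination (2 / 5 : ℂ) * I_sq, kroneckerE₁_add_I]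
  have h32 : kroneckerE₁ (u + (3 + 2 * I) / 5) = kroneckerE₁ (u + I * ((2 + 2 * I) / 5)) := by
    rw [show u + (3 + 2 * I) / 5 = (u + I * ((2 + 2 * I) / 5)) + 1 by
      linear_combination (-2 / 5 : ℂ) * I_sq, kroneckerE₁_add_one]
  rw [h01, h02, h03, h04, h30, h40, h33, h44, h14, h41, h23, h32]
  ring


/-! ### Symmetries of the twisted fifth-division sum -/

/-- `F(−u) = −F(u)` for the twisted fifth-division sum (oddness of `E₁*`; the orbits are
symmetric). [folklore] -/
theorem fifth_twisted_sum_neg (u : ℂ) :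
    ∑ b : ZMod 5 × ZMod 5, ((jacobiSym (rep 5 b 0).norm 5 : ℤ) : ℂ) *
        kroneckerE₁ (-u + (rep 5 b 0 : ℂ) / 5) =
      -∑ b : ZMod 5 × ZMod 5, ((jacobiSym (rep 5 b 0).norm 5 : ℤ) : ℂ) *
        kroneckerE₁ (u + (rep 5 b 0 : ℂ) / 5) := by
  rw [fifth_twisted_sum_expand, fifth_twisted_sum_expand]
  have h1 : ∀ w, kroneckerE₁ (-u + w) = -kroneckerE₁ (u - w) := fun w ↦ by
    rw [← kroneckerE₁_neg]; ring_nf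
  have h2 : ∀ w, kroneckerE₁ (-u - w) = -kroneckerE₁ (u + w) := fun w ↦ by
    rw [← kroneckerE₁_neg]; ring_nf
  simp only [h1, h2]
  ring

/-- `F(iu) = −iF(u)` for the twisted fifth-division sum (`E₁*(iz) = −iE₁*(z)`; the orbits and
`χ₅` are stable under multiplication by `i`). [folklore] -/
theorem fifth_twisted_sum_I_mul (u : ℂ) :
    ∑ b : ZMod 5 × ZMod 5, ((jacobiSym (rep 5 b 0).norm 5 : ℤ) : ℂ) *
        kroneckerE₁ (I * u + (rep 5 b 0 : ℂ) / 5) =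
      -I * ∑ b : ZMod 5 × ZMod 5, ((jacobiSym (rep 5 b 0).norm 5 : ℤ) : ℂ) *
        kroneckerE₁ (u + (rep 5 b 0 : ℂ) / 5) := by
  rw [fifth_twisted_sum_expand, fifth_twisted_sum_expand]
  have h1 : ∀ w, kroneckerE₁ (I * u + w) = -I * kroneckerE₁ (u - I * w) := fun w ↦ by
    rw [← kroneckerE₁_I_mul]; congr 1; linear_combination w * I_sq
  have h2 : ∀ w, kroneckerE₁ (I * u - w) = -I * kroneckerE₁ (u + I * w) := fun w ↦ by
    rw [← kroneckerE₁_I_mul]; congr 1; linear_combination (-w) * I_sq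
  have h3 : ∀ x, kroneckerE₁ (u - I * (I * x)) = kroneckerE₁ (u + x) := fun x ↦ by
    congr 1; linear_combination (-x) * I_sq
  have h4 : ∀ x, kroneckerE₁ (u + I * (I * x)) = kroneckerE₁ (u - x) := fun x ↦ by
    congr 1; linear_combination x * I_sq
  simp only [h1, h2, h3, h4]
  ring

/-- `F(u + l) = F(u)` for `l ∈ Λ` (`Λ`-periodicity of `E₁*`). [folklore] -/
theorem fifth_twisted_sum_add_of_mem (u : ℂ) {l : ℂ}
    (hl : l ∈ (ofUpperHalfPlane UpperHalfPlane.I).lattice) :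
    ∑ b : ZMod 5 × ZMod 5, ((jacobiSym (rep 5 b 0).norm 5 : ℤ) : ℂ) *
        kroneckerE₁ (u + l + (rep 5 b 0 : ℂ) / 5) =
      ∑ b : ZMod 5 × ZMod 5, ((jacobiSym (rep 5 b 0).norm 5 : ℤ) : ℂ) *
        kroneckerE₁ (u + (rep 5 b 0 : ℂ) / 5) := by
  rw [fifth_twisted_sum_expand, fifth_twisted_sum_expand]
  have h1 : ∀ w, kroneckerE₁ (u + l + w) = kroneckerE₁ (u + w) := fun w ↦ by
    rw [show u + l + w = u + w + l by ring, kroneckerE₁_add_of_mem _ hl]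
  have h2 : ∀ w, kroneckerE₁ (u + l - w) = kroneckerE₁ (u - w) := fun w ↦ by
    rw [show u + l - w = u - w + l by ring, kroneckerE₁_add_of_mem _ hl]
  simp only [h1, h2]

/-! ### Unit-equivariant functions on the quarter classes -/

/-- **The eight odd quarter classes for a unit-equivariant `Λ`-periodic function**: if
`F(−u) = −F(u)`, `F(iu) = −iF(u)` and `F(u + l) = F(u)` (`l ∈ Λ`), then the values of `F` at
`3/4, i/4, 3i/4` are `−F₁, −iF₁, iF₁` and at `(1+2i)/4, (2+i)/4, (2+3i)/4` are `−F₂, iF₂, −iF₂`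
(`F₁ = F(1/4)`, `F₂ = F((3+2i)/4)`). [folklore] -/
theorem quarter_classes_of_symm (F : ℂ → ℂ) (hneg : ∀ u, F (-u) = -F u)
    (hI : ∀ u, F (I * u) = -I * F u)
    (hper : ∀ u l, l ∈ (ofUpperHalfPlane UpperHalfPlane.I).lattice → F (u + l) = F u) :
    F ((3 : ℂ) / 4) = -F (1 / 4) ∧ F (I / 4) = -I * F (1 / 4) ∧ F (3 * I / 4) = I * F (1 / 4) ∧
    F ((1 + 2 * I) / 4) = -F ((3 + 2 * I) / 4) ∧ F ((2 + I) / 4) = I * F ((3 + 2 * I) / 4) ∧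
    F ((2 + 3 * I) / 4) = -I * F ((3 + 2 * I) / 4) := by
  have h3 : F ((3 : ℂ) / 4) = -F (1 / 4) := by
    rw [show ((3 : ℂ) / 4) = -(1 / 4) + 1 by norm_num, hper _ _ one_mem, hneg]
  refine ⟨h3, ?_, ?_, ?_, ?_, ?_⟩
  · rw [show (I / 4 : ℂ) = I * (1 / 4) by ring, hI]
  · rw [show (3 * I / 4 : ℂ) = I * (3 / 4) by ring, hI, h3]; ring
  · rw [show ((1 + 2 * I) / 4 : ℂ) = -((3 + 2 * I) / 4) + (1 + I) by ring,
      hper _ _ one_add_I_mem, hneg]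
  · have h1 : F (I * ((2 + I) / 4)) = -I * F ((2 + I) / 4) := hI _
    have h2 : I * ((2 + I) / 4) = (3 + 2 * I) / 4 + (-1) := by linear_combination I_sq / 4
    rw [h2, show ((3 + 2 * I) / 4 + (-1) : ℂ) = ((3 + 2 * I) / 4 - 1) by ring] at h1
    have h4 := hper ((3 + 2 * I) / 4 - 1) 1 one_mem
    rw [sub_add_cancel] at h4
    rw [← h4] at h1
    linear_combination (-I) * h1 + F ((2 + I) / 4) * I_sq
  · have h1 : F (I * ((2 + 3 * I) / 4)) = -I * F ((2 + 3 * I) / 4) := hI _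
    have h2 : I * ((2 + 3 * I) / 4) = -((3 + 2 * I) / 4 - I) := by linear_combination 3 * I_sq / 4
    rw [h2, hneg] at h1
    have h4 := hper ((3 + 2 * I) / 4 - I) I I_mem
    rw [sub_add_cancel] at h4
    rw [← h4] at h1
    linear_combination (-I) * h1 + F ((2 + 3 * I) / 4) * I_sq

/-- **The `ψ₂`-weighted sum over `ℤ[i]/4` of a unit-equivariant `Λ`-periodic function**:
`Σ_{a mod 4} ψ₂(a) conj F(a/4) = 4(conj F(1/4) − conj F((3+2i)/4))` (the eight odd classes are
the unit orbits of `1` and `3 + 2i`, on which `ψ₂ · conj F` is constant, with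
`(2/N(1)) = 1`, `(2/N(3+2i)) = −1`). [folklore] -/
theorem sum_heckePsi_two_mul_conj_eq (F : ℂ → ℂ) (hneg : ∀ u, F (-u) = -F u)
    (hI : ∀ u, F (I * u) = -I * F u)
    (hper : ∀ u l, l ∈ (ofUpperHalfPlane UpperHalfPlane.I).lattice → F (u + l) = F u) :
    ∑ c : ZMod 4 × ZMod 4, heckePsi 2 (rep 4 c 0) * conj (F ((rep 4 c 0 : ℂ) / 4)) =
      4 * (conj (F (1 / 4)) - conj (F ((3 + 2 * I) / 4))) := by
  obtain ⟨r00, r01, r02, r03, r10, r11, r12, r13, r20, r21, r22, r23, r30, r31, r32, r33⟩ :=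
    rep_four_values
  obtain ⟨v10, v30, v01, v03, v12, v32, v21, v23, v00, v11, v20, v02, v22, v13, v31, v33⟩ :=
    heckePsi_two_values
  obtain ⟨k3, kI, k3I, k12, k21, k23⟩ := quarter_classes_of_symm F hneg hI hper
  rw [sum_zmod_four_prod]
  simp only [r00, r01, r02, r03, r10, r11, r12, r13, r20, r21, r22, r23, r30, r31, r32, r33,
    v10, v30, v01, v03, v12, v32, v21, v23, v00, v11, v20, v02, v22, v13, v31, v33,
    zero_mul, add_zero, zero_add]
  simp only [GaussianInt.toComplex_def', Int.cast_zero, Int.cast_one, Int.cast_ofNat, zero_mul,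
    add_zero, zero_add, one_mul]
  rw [k3, kI, k3I, k12, k21, k23]
  simp only [map_neg, map_mul, Complex.conj_I]
  linear_combination (-2 * conj (F (1 / 4)) + 2 * conj (F ((3 + 2 * I) / 4))) * I_sq

/-- **`Σ_{a mod 4} ψ₂(a) conj FS(a/4) = 4(conj FS(1/4) − conj FS((3+2i)/4))`** for the twisted
fifth-division sum `FS(u) = Σ_{b mod 5} (N b/5) E₁*(u + b/5)`. [folklore] -/
theorem sum_heckePsi_two_mul_conj_fifth_twisted_sum :
    ∑ a : ZMod 4 × ZMod 4, heckePsi 2 (rep 4 a 0) *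
        conj (∑ b : ZMod 5 × ZMod 5, ((jacobiSym (rep 5 b 0).norm 5 : ℤ) : ℂ) *
          kroneckerE₁ ((rep 4 a 0 : ℂ) / 4 + (rep 5 b 0 : ℂ) / 5)) =
      4 * (conj (∑ b : ZMod 5 × ZMod 5, ((jacobiSym (rep 5 b 0).norm 5 : ℤ) : ℂ) *
          kroneckerE₁ (1 / 4 + (rep 5 b 0 : ℂ) / 5)) -
        conj (∑ b : ZMod 5 × ZMod 5, ((jacobiSym (rep 5 b 0).norm 5 : ℤ) : ℂ) *
          kroneckerE₁ ((3 + 2 * I) / 4 + (rep 5 b 0 : ℂ) / 5))) :=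
  sum_heckePsi_two_mul_conj_eq
    (fun u ↦ ∑ b : ZMod 5 × ZMod 5, ((jacobiSym (rep 5 b 0).norm 5 : ℤ) : ℂ) *
      kroneckerE₁ (u + (rep 5 b 0 : ℂ) / 5))
    fifth_twisted_sum_neg fifth_twisted_sum_I_mul fun u _ hl ↦ fifth_twisted_sum_add_of_mem u hl

/-! ### The sum of `E₁*` over a unit orbit -/

/-- `P² − Q² ≠ 0` from `P ≠ ±Q`. [folklore] -/
theorem sq_sub_sq_ne_zero_of_ne {P Q : ℂ} (h1 : P ≠ Q) (h2 : P ≠ -Q) : P ^ 2 - Q ^ 2 ≠ 0 := by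
  rw [show P ^ 2 - Q ^ 2 = (P - Q) * (P - -Q) by ring]
  exact mul_ne_zero (sub_ne_zero.mpr h1) (sub_ne_zero.mpr h2)

/-- **The sum of `E₁*` over a unit orbit**:
`E₁*(u+v) + E₁*(u−v) + E₁*(u+iv) + E₁*(u−iv) = 4E₁*(u) + 2℘'(u)℘(u)/(℘(u)² − ℘(v)²)` for
`u, v ∉ Λ`, `℘(u) ≠ ±℘(v)` (twice `kroneckerE₁_add_add_sub`, with `℘(iv) = −℘(v)`). [folklore] -/
theorem kroneckerE₁_unit_orbit_sum {u v : ℂ} (hu : u ∉ (ofUpperHalfPlane UpperHalfPlane.I).lattice)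
    (hv : v ∉ (ofUpperHalfPlane UpperHalfPlane.I).lattice)
    (h1 : ℘[ofUpperHalfPlane UpperHalfPlane.I] u ≠ ℘[ofUpperHalfPlane UpperHalfPlane.I] v)
    (h2 : ℘[ofUpperHalfPlane UpperHalfPlane.I] u ≠ -℘[ofUpperHalfPlane UpperHalfPlane.I] v) :
    kroneckerE₁ (u + v) + kroneckerE₁ (u - v) + kroneckerE₁ (u + I * v) + kroneckerE₁ (u - I * v) =
      4 * kroneckerE₁ u + 2 * ℘'[ofUpperHalfPlane UpperHalfPlane.I] u * ℘[ofUpperHalfPlane UpperHalfPlane.I] u /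
        (℘[ofUpperHalfPlane UpperHalfPlane.I] u ^ 2 - ℘[ofUpperHalfPlane UpperHalfPlane.I] v ^ 2) := by
  have hIv : I * v ∉ (ofUpperHalfPlane UpperHalfPlane.I).lattice := fun h ↦
    hv ((I_mul_mem_lattice_ofUpperHalfPlane_I_iff v).mp h)
  have h2' : ℘[ofUpperHalfPlane UpperHalfPlane.I] u ≠ ℘[ofUpperHalfPlane UpperHalfPlane.I] (I * v) := by
    rwa [GaussianLattice.weierstrassP_I_mul]
  have e1 := kroneckerE₁_add_add_sub hu hv h1
  have e2 := kroneckerE₁_add_add_sub hu hIv h2'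
  rw [GaussianLattice.weierstrassP_I_mul] at e2
  have key : ℘'[ofUpperHalfPlane UpperHalfPlane.I] u / (℘[ofUpperHalfPlane UpperHalfPlane.I] u - ℘[ofUpperHalfPlane UpperHalfPlane.I] v) +
      ℘'[ofUpperHalfPlane UpperHalfPlane.I] u / (℘[ofUpperHalfPlane UpperHalfPlane.I] u - -℘[ofUpperHalfPlane UpperHalfPlane.I] v) =
      2 * ℘'[ofUpperHalfPlane UpperHalfPlane.I] u * ℘[ofUpperHalfPlane UpperHalfPlane.I] u /
        (℘[ofUpperHalfPlane UpperHalfPlane.I] u ^ 2 - ℘[ofUpperHalfPlane UpperHalfPlane.I] v ^ 2) := by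
    rw [div_add_div _ _ (sub_ne_zero.mpr h1) (sub_ne_zero.mpr h2),
      div_eq_div_iff (mul_ne_zero (sub_ne_zero.mpr h1) (sub_ne_zero.mpr h2)) (sq_sub_sq_ne_zero_of_ne h1 h2)]
    ring
  linear_combination e1 + e2 + key

/-- Combining the two orbit terms of a `ℚ(√5)`-conjugate pair through the symmetric functions:
`X/(T − t₁) + X/(T − t₂) = X(2T − s)/(T² − sT + p)` for `t₁ + t₂ = s`, `t₁t₂ = p`. [folklore] -/
theorem two_orbit_combine {T t₁ t₂ s p X : ℂ} (hs : t₁ + t₂ = s) (hp : t₁ * t₂ = p)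
    (h1 : T - t₁ ≠ 0) (h2 : T - t₂ ≠ 0) :
    X / (T - t₁) + X / (T - t₂) = X * (2 * T - s) / (T ^ 2 - s * T + p) := by
  have hD : T ^ 2 - s * T + p = (T - t₁) * (T - t₂) := by rw [← hs, ← hp]; ring
  rw [hD, div_add_div _ _ h1 h2, div_eq_div_iff (mul_ne_zero h1 h2) (mul_ne_zero h1 h2), ← hs]
  ring

/-! ### The two values of the twisted fifth-division sum -/

/-- **The twisted fifth-division sum at `u = 1/4`**: `FS(1/4) = 2√2·√5·ϖ₀ = 2√10 ϖ₀`. With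
`P = ℘(1/4) = (1+√2)ϖ₀²`, `P' = ℘'(1/4) = −2√2(1+√2)ϖ₀³` and the symmetric functions of the
squared fifth-division values (`s± = (6 ± 4√5)ϖ₀⁴`, `p± = (9 ± 4√5)ϖ₀⁸`),
`FS(1/4) = 2P'P[(2P² − s₊)/(P⁴ − s₊P² + p₊) − (2P² − s₋)/(P⁴ − s₋P² + p₋)]`, an identity in
`ℚ(√2, √5)ϖ₀` (the denominators are `Π(P² − ℘(v)²) ≠ 0` over the orbit representatives `v`).
[folklore] -/
theorem fifth_twisted_sum_quarter :
    ∑ b : ZMod 5 × ZMod 5, ((jacobiSym (rep 5 b 0).norm 5 : ℤ) : ℂ) *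
          kroneckerE₁ (1 / 4 + (rep 5 b 0 : ℂ) / 5) =
      2 * (Real.sqrt 2 : ℂ) * (Real.sqrt 5 : ℂ) * ((Real.Gamma (1 / 4) ^ 2 / (2 * Real.sqrt (2 * π)) : ℝ) : ℂ) := by
  have hu : (1 / 4 : ℂ) ∉ (ofUpperHalfPlane UpperHalfPlane.I).lattice := one_quarter_notMem
  have h4u : 4 * (1 / 4 : ℂ) ∈ (ofUpperHalfPlane UpperHalfPlane.I).lattice := by
    rw [show (4 : ℂ) * (1 / 4) = 1 by norm_num]; exact one_mem
  have h5v₁ : 5 * (1 / 5 : ℂ) ∈ (ofUpperHalfPlane UpperHalfPlane.I).lattice := by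
    rw [show (5 : ℂ) * (1 / 5) = 1 by norm_num]; exact one_mem
  have h5v₂ : 5 * (2 / 5 : ℂ) ∈ (ofUpperHalfPlane UpperHalfPlane.I).lattice := by
    rw [show (5 : ℂ) * (2 / 5) = 1 + 1 by norm_num]; exact add_mem one_mem one_mem
  have h5v₃ : 5 * ((1 + I) / 5 : ℂ) ∈ (ofUpperHalfPlane UpperHalfPlane.I).lattice := by
    rw [show (5 : ℂ) * ((1 + I) / 5) = 1 + I by ring]; exact one_add_I_mem
  have h5v₄ : 5 * ((2 + 2 * I) / 5 : ℂ) ∈ (ofUpperHalfPlane UpperHalfPlane.I).lattice := by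
    rw [show (5 : ℂ) * ((2 + 2 * I) / 5) = (1 + I) + (1 + I) by ring]
    exact add_mem one_add_I_mem one_add_I_mem
  obtain ⟨h11, h12⟩ := weierstrassP_quarter_ne_fifth hu one_fifth_notMem h4u h5v₁
  obtain ⟨h21, h22⟩ := weierstrassP_quarter_ne_fifth hu two_fifths_notMem h4u h5v₂
  obtain ⟨h31, h32⟩ := weierstrassP_quarter_ne_fifth hu one_add_I_fifth_notMem h4u h5v₃
  obtain ⟨h41, h42⟩ := weierstrassP_quarter_ne_fifth hu two_add_two_I_fifth_notMem h4u h5v₄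
  rw [fifth_twisted_sum_expand, kroneckerE₁_unit_orbit_sum hu one_fifth_notMem h11 h12,
    kroneckerE₁_unit_orbit_sum hu two_fifths_notMem h21 h22,
    kroneckerE₁_unit_orbit_sum hu one_add_I_fifth_notMem h31 h32,
    kroneckerE₁_unit_orbit_sum hu two_add_two_I_fifth_notMem h41 h42]
  obtain ⟨hsp, hpp⟩ := weierstrassP_fifth_sum_sq_and_prod_sq
  obtain ⟨hsm, hpm⟩ := fifth_diag_sum_sq_and_prod_sq
  have e12 := two_orbit_combine (X := 2 * ℘'[ofUpperHalfPlane UpperHalfPlane.I] (1 / 4) * ℘[ofUpperHalfPlane UpperHalfPlane.I] (1 / 4)) hsp hpp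
    (sq_sub_sq_ne_zero_of_ne h11 h12) (sq_sub_sq_ne_zero_of_ne h21 h22)
  have e34 := two_orbit_combine (X := 2 * ℘'[ofUpperHalfPlane UpperHalfPlane.I] (1 / 4) * ℘[ofUpperHalfPlane UpperHalfPlane.I] (1 / 4)) hsm hpm
    (sq_sub_sq_ne_zero_of_ne h31 h32) (sq_sub_sq_ne_zero_of_ne h41 h42)
  have main : 2 * ℘'[ofUpperHalfPlane UpperHalfPlane.I] (1 / 4) * ℘[ofUpperHalfPlane UpperHalfPlane.I] (1 / 4) * (2 * ℘[ofUpperHalfPlane UpperHalfPlane.I] (1 / 4) ^ 2 - (6 + 4 * (Real.sqrt 5 : ℂ)) * ((Real.Gamma (1 / 4) ^ 2 / (2 * Real.sqrt (2 * π)) : ℝ) : ℂ) ^ 4) /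
        ((℘[ofUpperHalfPlane UpperHalfPlane.I] (1 / 4) ^ 2) ^ 2 - (6 + 4 * (Real.sqrt 5 : ℂ)) * ((Real.Gamma (1 / 4) ^ 2 / (2 * Real.sqrt (2 * π)) : ℝ) : ℂ) ^ 4 * ℘[ofUpperHalfPlane UpperHalfPlane.I] (1 / 4) ^ 2 +
          (9 + 4 * (Real.sqrt 5 : ℂ)) * ((Real.Gamma (1 / 4) ^ 2 / (2 * Real.sqrt (2 * π)) : ℝ) : ℂ) ^ 8) -
      2 * ℘'[ofUpperHalfPlane UpperHalfPlane.I] (1 / 4) * ℘[ofUpperHalfPlane UpperHalfPlane.I] (1 / 4) * (2 * ℘[ofUpperHalfPlane UpperHalfPlane.I] (1 / 4) ^ 2 - (6 - 4 * (Real.sqrt 5 : ℂ)) * ((Real.Gamma (1 / 4) ^ 2 / (2 * Real.sqrt (2 * π)) : ℝ) : ℂ) ^ 4) /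
        ((℘[ofUpperHalfPlane UpperHalfPlane.I] (1 / 4) ^ 2) ^ 2 - (6 - 4 * (Real.sqrt 5 : ℂ)) * ((Real.Gamma (1 / 4) ^ 2 / (2 * Real.sqrt (2 * π)) : ℝ) : ℂ) ^ 4 * ℘[ofUpperHalfPlane UpperHalfPlane.I] (1 / 4) ^ 2 +
          (9 - 4 * (Real.sqrt 5 : ℂ)) * ((Real.Gamma (1 / 4) ^ 2 / (2 * Real.sqrt (2 * π)) : ℝ) : ℂ) ^ 8) =
      2 * (Real.sqrt 2 : ℂ) * (Real.sqrt 5 : ℂ) * ((Real.Gamma (1 / 4) ^ 2 / (2 * Real.sqrt (2 * π)) : ℝ) : ℂ) := by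
    have hDp : (℘[ofUpperHalfPlane UpperHalfPlane.I] (1 / 4) ^ 2) ^ 2 - (6 + 4 * (Real.sqrt 5 : ℂ)) * ((Real.Gamma (1 / 4) ^ 2 / (2 * Real.sqrt (2 * π)) : ℝ) : ℂ) ^ 4 * ℘[ofUpperHalfPlane UpperHalfPlane.I] (1 / 4) ^ 2 +
        (9 + 4 * (Real.sqrt 5 : ℂ)) * ((Real.Gamma (1 / 4) ^ 2 / (2 * Real.sqrt (2 * π)) : ℝ) : ℂ) ^ 8 ≠ 0 := by
      rw [show (℘[ofUpperHalfPlane UpperHalfPlane.I] (1 / 4) ^ 2) ^ 2 - (6 + 4 * (Real.sqrt 5 : ℂ)) * ((Real.Gamma (1 / 4) ^ 2 / (2 * Real.sqrt (2 * π)) : ℝ) : ℂ) ^ 4 * ℘[ofUpperHalfPlane UpperHalfPlane.I] (1 / 4) ^ 2 +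
          (9 + 4 * (Real.sqrt 5 : ℂ)) * ((Real.Gamma (1 / 4) ^ 2 / (2 * Real.sqrt (2 * π)) : ℝ) : ℂ) ^ 8 =
          (℘[ofUpperHalfPlane UpperHalfPlane.I] (1 / 4) ^ 2 - ℘[ofUpperHalfPlane UpperHalfPlane.I] (1 / 5) ^ 2) *
            (℘[ofUpperHalfPlane UpperHalfPlane.I] (1 / 4) ^ 2 - ℘[ofUpperHalfPlane UpperHalfPlane.I] (2 / 5) ^ 2) by
        rw [← hsp, ← hpp]; ring]
      exact mul_ne_zero (sq_sub_sq_ne_zero_of_ne h11 h12) (sq_sub_sq_ne_zero_of_ne h21 h22)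
    have hDm : (℘[ofUpperHalfPlane UpperHalfPlane.I] (1 / 4) ^ 2) ^ 2 - (6 - 4 * (Real.sqrt 5 : ℂ)) * ((Real.Gamma (1 / 4) ^ 2 / (2 * Real.sqrt (2 * π)) : ℝ) : ℂ) ^ 4 * ℘[ofUpperHalfPlane UpperHalfPlane.I] (1 / 4) ^ 2 +
        (9 - 4 * (Real.sqrt 5 : ℂ)) * ((Real.Gamma (1 / 4) ^ 2 / (2 * Real.sqrt (2 * π)) : ℝ) : ℂ) ^ 8 ≠ 0 := by
      rw [show (℘[ofUpperHalfPlane UpperHalfPlane.I] (1 / 4) ^ 2) ^ 2 - (6 - 4 * (Real.sqrt 5 : ℂ)) * ((Real.Gamma (1 / 4) ^ 2 / (2 * Real.sqrt (2 * π)) : ℝ) : ℂ) ^ 4 * ℘[ofUpperHalfPlane UpperHalfPlane.I] (1 / 4) ^ 2 +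
          (9 - 4 * (Real.sqrt 5 : ℂ)) * ((Real.Gamma (1 / 4) ^ 2 / (2 * Real.sqrt (2 * π)) : ℝ) : ℂ) ^ 8 =
          (℘[ofUpperHalfPlane UpperHalfPlane.I] (1 / 4) ^ 2 - ℘[ofUpperHalfPlane UpperHalfPlane.I] ((1 + I) / 5) ^ 2) *
            (℘[ofUpperHalfPlane UpperHalfPlane.I] (1 / 4) ^ 2 - ℘[ofUpperHalfPlane UpperHalfPlane.I] ((2 + 2 * I) / 5) ^ 2) by
        rw [← hsm, ← hpm]; ring]
      exact mul_ne_zero (sq_sub_sq_ne_zero_of_ne h31 h32) (sq_sub_sq_ne_zero_of_ne h41 h42)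
    rw [div_sub_div _ _ hDp hDm, div_eq_iff (mul_ne_zero hDp hDm), weierstrassP_quarter,
      derivWeierstrassP_quarter]
    set r : ℂ := (Real.sqrt 2 : ℂ) with hr
    set f : ℂ := (Real.sqrt 5 : ℂ) with hf
    set w : ℂ := ((Real.Gamma (1 / 4) ^ 2 / (2 * Real.sqrt (2 * π)) : ℝ) : ℂ) with hw
    have hr2 : r ^ 2 = 2 := by
      rw [hr, ← Complex.ofReal_pow, Real.sq_sqrt (by norm_num)]; push_cast; ring
    have hf5 : f ^ 2 = 5 := by
      rw [hf, ← Complex.ofReal_pow, Real.sq_sqrt (by norm_num)]; push_cast; ring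
    linear_combination ((-2) * r ^ 7 * f * w ^ 17 + (-16) * r ^ 6 * f * w ^ 17 + (32) * r ^ 3 * f ^ 3 * w ^ 17 +
        (-68) * r ^ 5 * f * w ^ 17 + (128) * r ^ 2 * f ^ 3 * w ^ 17 +
        (-192) * r ^ 4 * f * w ^ 17 + (192) * r * f ^ 3 * w ^ 17 + (-440) * r ^ 3 * f * w ^ 17 +
        (256) * f ^ 3 * w ^ 17 + (-832) * r ^ 2 * f * w ^ 17 + (-1008) * r * f * w ^ 17 +
        (-1280) * f * w ^ 17) * hr2 +
      ((384) * r * f * w ^ 17 + (512) * f * w ^ 17) * hf5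
  linear_combination e12 - e34 + main

/-- **The twisted fifth-division sum at `u = (3+2i)/4`**: `FS((3+2i)/4) = −2√10 ϖ₀`
(`℘ = (1−√2)ϖ₀²`, `℘' = −2(2−√2)ϖ₀³` there). [folklore] -/
theorem fifth_twisted_sum_three_add_two_I_quarter :
    ∑ b : ZMod 5 × ZMod 5, ((jacobiSym (rep 5 b 0).norm 5 : ℤ) : ℂ) *
          kroneckerE₁ ((3 + 2 * I) / 4 + (rep 5 b 0 : ℂ) / 5) =
      -(2 * (Real.sqrt 2 : ℂ) * (Real.sqrt 5 : ℂ) * ((Real.Gamma (1 / 4) ^ 2 / (2 * Real.sqrt (2 * π)) : ℝ) : ℂ)) := by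
  have hu : ((3 + 2 * I) / 4 : ℂ) ∉ (ofUpperHalfPlane UpperHalfPlane.I).lattice := three_add_two_I_quarter_notMem
  have h4u : 4 * ((3 + 2 * I) / 4 : ℂ) ∈ (ofUpperHalfPlane UpperHalfPlane.I).lattice := by
    rw [show (4 : ℂ) * ((3 + 2 * I) / 4) = 1 + (1 + I) + (1 + I) by ring]
    exact add_mem (add_mem one_mem one_add_I_mem) one_add_I_mem
  have h5v₁ : 5 * (1 / 5 : ℂ) ∈ (ofUpperHalfPlane UpperHalfPlane.I).lattice := by
    rw [show (5 : ℂ) * (1 / 5) = 1 by norm_num]; exact one_mem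
  have h5v₂ : 5 * (2 / 5 : ℂ) ∈ (ofUpperHalfPlane UpperHalfPlane.I).lattice := by
    rw [show (5 : ℂ) * (2 / 5) = 1 + 1 by norm_num]; exact add_mem one_mem one_mem
  have h5v₃ : 5 * ((1 + I) / 5 : ℂ) ∈ (ofUpperHalfPlane UpperHalfPlane.I).lattice := by
    rw [show (5 : ℂ) * ((1 + I) / 5) = 1 + I by ring]; exact one_add_I_mem
  have h5v₄ : 5 * ((2 + 2 * I) / 5 : ℂ) ∈ (ofUpperHalfPlane UpperHalfPlane.I).lattice := by
    rw [show (5 : ℂ) * ((2 + 2 * I) / 5) = (1 + I) + (1 + I) by ring]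
    exact add_mem one_add_I_mem one_add_I_mem
  obtain ⟨h11, h12⟩ := weierstrassP_quarter_ne_fifth hu one_fifth_notMem h4u h5v₁
  obtain ⟨h21, h22⟩ := weierstrassP_quarter_ne_fifth hu two_fifths_notMem h4u h5v₂
  obtain ⟨h31, h32⟩ := weierstrassP_quarter_ne_fifth hu one_add_I_fifth_notMem h4u h5v₃
  obtain ⟨h41, h42⟩ := weierstrassP_quarter_ne_fifth hu two_add_two_I_fifth_notMem h4u h5v₄
  rw [fifth_twisted_sum_expand, kroneckerE₁_unit_orbit_sum hu one_fifth_notMem h11 h12,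
    kroneckerE₁_unit_orbit_sum hu two_fifths_notMem h21 h22,
    kroneckerE₁_unit_orbit_sum hu one_add_I_fifth_notMem h31 h32,
    kroneckerE₁_unit_orbit_sum hu two_add_two_I_fifth_notMem h41 h42]
  obtain ⟨hsp, hpp⟩ := weierstrassP_fifth_sum_sq_and_prod_sq
  obtain ⟨hsm, hpm⟩ := fifth_diag_sum_sq_and_prod_sq
  have e12 := two_orbit_combine (X := 2 * ℘'[ofUpperHalfPlane UpperHalfPlane.I] ((3 + 2 * I) / 4) * ℘[ofUpperHalfPlane UpperHalfPlane.I] ((3 + 2 * I) / 4)) hsp hpp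
    (sq_sub_sq_ne_zero_of_ne h11 h12) (sq_sub_sq_ne_zero_of_ne h21 h22)
  have e34 := two_orbit_combine (X := 2 * ℘'[ofUpperHalfPlane UpperHalfPlane.I] ((3 + 2 * I) / 4) * ℘[ofUpperHalfPlane UpperHalfPlane.I] ((3 + 2 * I) / 4)) hsm hpm
    (sq_sub_sq_ne_zero_of_ne h31 h32) (sq_sub_sq_ne_zero_of_ne h41 h42)
  have main : 2 * ℘'[ofUpperHalfPlane UpperHalfPlane.I] ((3 + 2 * I) / 4) * ℘[ofUpperHalfPlane UpperHalfPlane.I] ((3 + 2 * I) / 4) * (2 * ℘[ofUpperHalfPlane UpperHalfPlane.I] ((3 + 2 * I) / 4) ^ 2 - (6 + 4 * (Real.sqrt 5 : ℂ)) * ((Real.Gamma (1 / 4) ^ 2 / (2 * Real.sqrt (2 * π)) : ℝ) : ℂ) ^ 4) /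
        ((℘[ofUpperHalfPlane UpperHalfPlane.I] ((3 + 2 * I) / 4) ^ 2) ^ 2 - (6 + 4 * (Real.sqrt 5 : ℂ)) * ((Real.Gamma (1 / 4) ^ 2 / (2 * Real.sqrt (2 * π)) : ℝ) : ℂ) ^ 4 * ℘[ofUpperHalfPlane UpperHalfPlane.I] ((3 + 2 * I) / 4) ^ 2 +
          (9 + 4 * (Real.sqrt 5 : ℂ)) * ((Real.Gamma (1 / 4) ^ 2 / (2 * Real.sqrt (2 * π)) : ℝ) : ℂ) ^ 8) -
      2 * ℘'[ofUpperHalfPlane UpperHalfPlane.I] ((3 + 2 * I) / 4) * ℘[ofUpperHalfPlane UpperHalfPlane.I] ((3 + 2 * I) / 4) * (2 * ℘[ofUpperHalfPlane UpperHalfPlane.I] ((3 + 2 * I) / 4) ^ 2 - (6 - 4 * (Real.sqrt 5 : ℂ)) * ((Real.Gamma (1 / 4) ^ 2 / (2 * Real.sqrt (2 * π)) : ℝ) : ℂ) ^ 4) /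
        ((℘[ofUpperHalfPlane UpperHalfPlane.I] ((3 + 2 * I) / 4) ^ 2) ^ 2 - (6 - 4 * (Real.sqrt 5 : ℂ)) * ((Real.Gamma (1 / 4) ^ 2 / (2 * Real.sqrt (2 * π)) : ℝ) : ℂ) ^ 4 * ℘[ofUpperHalfPlane UpperHalfPlane.I] ((3 + 2 * I) / 4) ^ 2 +
          (9 - 4 * (Real.sqrt 5 : ℂ)) * ((Real.Gamma (1 / 4) ^ 2 / (2 * Real.sqrt (2 * π)) : ℝ) : ℂ) ^ 8) =
      -(2 * (Real.sqrt 2 : ℂ) * (Real.sqrt 5 : ℂ) * ((Real.Gamma (1 / 4) ^ 2 / (2 * Real.sqrt (2 * π)) : ℝ) : ℂ)) := by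
    have hDp : (℘[ofUpperHalfPlane UpperHalfPlane.I] ((3 + 2 * I) / 4) ^ 2) ^ 2 - (6 + 4 * (Real.sqrt 5 : ℂ)) * ((Real.Gamma (1 / 4) ^ 2 / (2 * Real.sqrt (2 * π)) : ℝ) : ℂ) ^ 4 * ℘[ofUpperHalfPlane UpperHalfPlane.I] ((3 + 2 * I) / 4) ^ 2 +
        (9 + 4 * (Real.sqrt 5 : ℂ)) * ((Real.Gamma (1 / 4) ^ 2 / (2 * Real.sqrt (2 * π)) : ℝ) : ℂ) ^ 8 ≠ 0 := by
      rw [show (℘[ofUpperHalfPlane UpperHalfPlane.I] ((3 + 2 * I) / 4) ^ 2) ^ 2 - (6 + 4 * (Real.sqrt 5 : ℂ)) * ((Real.Gamma (1 / 4) ^ 2 / (2 * Real.sqrt (2 * π)) : ℝ) : ℂ) ^ 4 * ℘[ofUpperHalfPlane UpperHalfPlane.I] ((3 + 2 * I) / 4) ^ 2 +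
          (9 + 4 * (Real.sqrt 5 : ℂ)) * ((Real.Gamma (1 / 4) ^ 2 / (2 * Real.sqrt (2 * π)) : ℝ) : ℂ) ^ 8 =
          (℘[ofUpperHalfPlane UpperHalfPlane.I] ((3 + 2 * I) / 4) ^ 2 - ℘[ofUpperHalfPlane UpperHalfPlane.I] (1 / 5) ^ 2) *
            (℘[ofUpperHalfPlane UpperHalfPlane.I] ((3 + 2 * I) / 4) ^ 2 - ℘[ofUpperHalfPlane UpperHalfPlane.I] (2 / 5) ^ 2) by
        rw [← hsp, ← hpp]; ring]
      exact mul_ne_zero (sq_sub_sq_ne_zero_of_ne h11 h12) (sq_sub_sq_ne_zero_of_ne h21 h22)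
    have hDm : (℘[ofUpperHalfPlane UpperHalfPlane.I] ((3 + 2 * I) / 4) ^ 2) ^ 2 - (6 - 4 * (Real.sqrt 5 : ℂ)) * ((Real.Gamma (1 / 4) ^ 2 / (2 * Real.sqrt (2 * π)) : ℝ) : ℂ) ^ 4 * ℘[ofUpperHalfPlane UpperHalfPlane.I] ((3 + 2 * I) / 4) ^ 2 +
        (9 - 4 * (Real.sqrt 5 : ℂ)) * ((Real.Gamma (1 / 4) ^ 2 / (2 * Real.sqrt (2 * π)) : ℝ) : ℂ) ^ 8 ≠ 0 := by
      rw [show (℘[ofUpperHalfPlane UpperHalfPlane.I] ((3 + 2 * I) / 4) ^ 2) ^ 2 - (6 - 4 * (Real.sqrt 5 : ℂ)) * ((Real.Gamma (1 / 4) ^ 2 / (2 * Real.sqrt (2 * π)) : ℝ) : ℂ) ^ 4 * ℘[ofUpperHalfPlane UpperHalfPlane.I] ((3 + 2 * I) / 4) ^ 2 +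
          (9 - 4 * (Real.sqrt 5 : ℂ)) * ((Real.Gamma (1 / 4) ^ 2 / (2 * Real.sqrt (2 * π)) : ℝ) : ℂ) ^ 8 =
          (℘[ofUpperHalfPlane UpperHalfPlane.I] ((3 + 2 * I) / 4) ^ 2 - ℘[ofUpperHalfPlane UpperHalfPlane.I] ((1 + I) / 5) ^ 2) *
            (℘[ofUpperHalfPlane UpperHalfPlane.I] ((3 + 2 * I) / 4) ^ 2 - ℘[ofUpperHalfPlane UpperHalfPlane.I] ((2 + 2 * I) / 5) ^ 2) by
        rw [← hsm, ← hpm]; ring]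
      exact mul_ne_zero (sq_sub_sq_ne_zero_of_ne h31 h32) (sq_sub_sq_ne_zero_of_ne h41 h42)
    rw [div_sub_div _ _ hDp hDm, div_eq_iff (mul_ne_zero hDp hDm), weierstrassP_three_add_two_I_quarter,
      derivWeierstrassP_three_add_two_I_quarter]
    set r : ℂ := (Real.sqrt 2 : ℂ) with hr
    set f : ℂ := (Real.sqrt 5 : ℂ) with hf
    set w : ℂ := ((Real.Gamma (1 / 4) ^ 2 / (2 * Real.sqrt (2 * π)) : ℝ) : ℂ) with hw
    have hr2 : r ^ 2 = 2 := by
      rw [hr, ← Complex.ofReal_pow, Real.sq_sqrt (by norm_num)]; push_cast; ring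
    have hf5 : f ^ 2 = 5 := by
      rw [hf, ← Complex.ofReal_pow, Real.sq_sqrt (by norm_num)]; push_cast; ring
    linear_combination ((2) * r ^ 7 * f * w ^ 17 + (-16) * r ^ 6 * f * w ^ 17 + (-32) * r ^ 3 * f ^ 3 * w ^ 17 +
        (36) * r ^ 5 * f * w ^ 17 + (128) * r ^ 2 * f ^ 3 * w ^ 17 + (-32) * r ^ 4 * f * w ^ 17 +
        (-192) * r * f ^ 3 * w ^ 17 + (184) * r ^ 3 * f * w ^ 17 + (256) * f ^ 3 * w ^ 17 +
        (-704) * r ^ 2 * f * w ^ 17 + (1136) * r * f * w ^ 17 + (-1408) * f * w ^ 17) * hr2 +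
      ((-384) * r * f * w ^ 17 + (512) * f * w ^ 17) * hf5
  linear_combination e12 - e34 + main

/-! ### `L(E₁₀, 1) = 2β/√10` and the discharge of `BirchSwinnertonDyer1965_L_one_two_ten` -/

/-- **`L(E₁₀, 1) = 2β/√10`** for `E₁₀ : y² = x³ − 100x`, `β = ∫₁^∞ dx/√(x³ − x)`
(Birch–Swinnerton-Dyer 1965, Table 1: `L(Γ₁₀₀, 1) = 100^{-1/4} · 2β`; read by Tunnell 1983,
p. 329, as the case `d = 5` of Theorem 3, `b(5) = 2`). Proof:
`L(E₁₀, 1) = (1/80) Σ_{a mod 4} ψ₂(a) conj FS(a/4) = (4/80)(conj FS(1/4) − conj FS((3+2i)/4))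
= (4/80) · 4√10 ϖ₀ = 2ϖ₀/√10` and `β = ϖ₀`. Numerically `L(E₁₀, 1) = 1.65835…` (LMFDB 3200.?;
`2 · 2.62206/3.16228`). [cite: Tunnell1983Congruent, proof of Thm 3, p. 329]
[cite: BirchSwinnertonDyer1965NotesII, Table 1] -/
theorem entireLFunction_congruentNumberCurve_ten_one :
    (congruentNumberCurve 10).entireLFunction 1 = ((2 * tunnellPeriod / Real.sqrt 10 : ℝ) : ℂ) := by
  rw [entireLFunction_congruentNumberCurve_ten_one_eq_sum, sum_heckePsi_two_mul_conj_fifth_twisted_sum,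
    fifth_twisted_sum_quarter, fifth_twisted_sum_three_add_two_I_quarter, tunnellPeriod_eq_varpi]
  have h10 : Real.sqrt 10 = Real.sqrt 2 * Real.sqrt 5 := by
    rw [show (10 : ℝ) = 2 * 5 by norm_num, Real.sqrt_mul (by norm_num) 5]
  have hrhs : ((2 * (Real.Gamma (1 / 4) ^ 2 / (2 * Real.sqrt (2 * π))) / (Real.sqrt 2 * Real.sqrt 5) : ℝ) : ℂ) =
      2 * ((Real.Gamma (1 / 4) ^ 2 / (2 * Real.sqrt (2 * π)) : ℝ) : ℂ) /
        ((Real.sqrt 2 : ℂ) * (Real.sqrt 5 : ℂ)) := by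
    push_cast; ring
  rw [h10, hrhs]
  set r : ℂ := (Real.sqrt 2 : ℂ) with hr
  set f : ℂ := (Real.sqrt 5 : ℂ) with hf
  set w : ℂ := ((Real.Gamma (1 / 4) ^ 2 / (2 * Real.sqrt (2 * π)) : ℝ) : ℂ) with hw
  have hr0 : r ≠ 0 := Complex.ofReal_ne_zero.mpr (by positivity)
  have hf0 : f ≠ 0 := Complex.ofReal_ne_zero.mpr (by positivity)
  have hr2 : r ^ 2 = 2 := by
    rw [hr, ← Complex.ofReal_pow, Real.sq_sqrt (by norm_num)]; push_cast; ring
  have hf5 : f ^ 2 = 5 := by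
    rw [hf, ← Complex.ofReal_pow, Real.sq_sqrt (by norm_num)]; push_cast; ring
  have hconj : conj (2 * r * f * w) = 2 * r * f * w := by
    rw [hr, hf, hw]; simp only [map_mul, map_ofNat, Complex.conj_ofReal]
  rw [map_neg, hconj, eq_div_iff (mul_ne_zero hr0 hf0)]
  linear_combination (1 / 5 : ℂ) * w * f ^ 2 * hr2 + (2 / 5 : ℂ) * w * hf5

/-- **The `E₁₀`-half of `BirchSwinnertonDyer1965_L_one_two_ten`, discharged.** [folklore] -/
theorem BirchSwinnertonDyer1965_L_one_ten :
    ((congruentNumberCurve 10).HasEntireLFunction →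
      (congruentNumberCurve 10).entireLFunction 1 = ((2 * tunnellPeriod / Real.sqrt 10 : ℝ) : ℂ)) :=
  fun _ ↦ entireLFunction_congruentNumberCurve_ten_one

/-- **Discharge of the named fact `BirchSwinnertonDyer1965_L_one_two_ten`**
(`BSDAnalyticRankTunnellWaldspurgerProofs`): `L(E₂, 1) = β/(2√2)` (`CongruentNumberCurveLValueTwo`)
and `L(E₁₀, 1) = 2β/√10` (this file), both unconditionally. [cite: Tunnell1983Congruent, proof of
Thm 3, p. 329] [cite: BirchSwinnertonDyer1965NotesII, Table 1] -/
theorem BirchSwinnertonDyer1965_L_one_two_ten_holds : BirchSwinnertonDyer1965_L_one_two_ten := by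
  unfold BirchSwinnertonDyer1965_L_one_two_ten
  exact ⟨BirchSwinnertonDyer1965_L_one_two, BirchSwinnertonDyer1965_L_one_ten⟩

/-- **Tunnell's Theorem 3, even case, from Waldspurger's proportionality alone**: with the two CM
`L`-values and the entire continuation now proved, `Tunnell1983_L_one_even` follows from the
single remaining named fact `Tunnell1983_b_sq_eq_const_mul_L_one` (Waldspurger's theorem for
Tunnell's forms, `χ₂`-twist: `b(n)² = c · L(E^{2n}, 1) √n` on the classes `n ≡ 1, 5 (8)`),
by `Tunnell1983_L_one_even_of_facts`. [cite: Tunnell1983Congruent, Thm 3 and its proof, p. 329] -/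
theorem Tunnell1983_L_one_even_of_b_sq (hW : Tunnell1983_b_sq_eq_const_mul_L_one) :
    Tunnell1983_L_one_even :=
  Tunnell1983_L_one_even_of_facts hW BirchSwinnertonDyer1965_L_one_two_ten_holds
    hasEntireLFunction_congruentNumberCurve_holds

end Literature.NumberTheory.EllipticCurves

end
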